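import Summits.Ventures.Crystal3D.Theorems.StickyWulffConstantPolycrystalWulffBoundSlideChimera
import Summits.Ventures.Crystal3D.Theorems.StickyWulffConstantPolycrystalWulffBoundLineTrimE3
import Summits.Ventures.Crystal3D.Theorems.StickyWulffConstantPolycrystalWulffBoundRungZone
import Summits.Ventures.Crystal3D.Theorems.StickyWulffConstantPolycrystalWulffBoundFacetAreaSymm
import Summits.Ventures.Crystal3D.Theorems.StickyWulffConstantPolycrystalWulffBoundRungSingleAxisTail

/-!
# `PolycrystalWulffBound`, line `PolyDensity`: the GENERAL SINGLE-AXIS RUNG (cell form)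

Route `StickyWulffConstant`, venture `Summits/Ventures/Crystal3D`, crux `PolycrystalWulffBound`
(`stmt-Ventures-19482`), second prover lane (poly-p2, gen 10).  TEXTURE: finitely many pairwise disjoint
bounded open convex cells `Q_j` with separating unit normals `ν_{jj'}` (antisymmetric,
`cl Q_j ∩ cl Q_j' ⊆ {⟪ν_{jj'}, x⟫ = b}`), frames `A_j` pairwise co-axial about `m` (crux clause `Ax m`),
labels `τ_j ∈ Bool` with equal labels ⇒ equal Wulff bodies, `u` a horizontal nearest-neighbour bond and
mirror normal of every lattice, `w ⊥ m, u` the corresponding horizontal `⟨112⟩` unit vector.  NO zone or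
lamellar condition — ARBITRARY polyhedral geometry.  CONCLUSION (`rung_singleAxis_cells`):
`6·2^{1/3}(√2·Vol)^{2/3} ≤ Fr + (1/√6)·Σ_{τ_j ≠ τ_j'} |⟪w, ν_{jj'}⟫|·facetArea(cl Q_j ∩ cl Q_j')`, i.e.
every twin wall of unit normal `ν` costs `(2/√6)|⟪w, ν⟫| ≤ (2/√6) sin∠(ν, m)` per area (the double sum
counts each wall twice); the best of the three `w` gives `≤ (1/√6) sin∠ < ½ sin∠` in aggregate.
PROOF: trim the cells of one label within `w`-distance `r·2/√6` of the other label
(`volume_lineTrimE3_le`), slide chimera on the trimmed cells (`slide_chimera_lower`), Minkowski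
content (`volume_chimera_texture_le`), cube expansion (`cube_tail_bound`), `r → 0`.
WHAT THIS IS NOT: the grain-level form with `ι_{[−w,w]}` (facet-calculus bookkeeping, next); multi-axis
textures; the crux is not claimed.
-/

noncomputable section

open scoped BigOperators InnerProductSpace ENNReal Pointwise
open MeasureTheory Filter Set

namespace Summit.Ventures.Crystal3D.Cruxes.PolycrystalWulffBound.PolyDensity

open Summit.Ventures.Crystal3D.Theorems
open Summit.Ventures.Crystal3D.Cruxes.TextureLiminf.TexShadow (per polytope E3 facetArea)
open Literature.MathematicalPhysics.StatisticalMechanics (fccStacking barlowStacking IsHaggSeq perimeter)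

/-- **Rung `rung_singleAxis_cells`** (let-vocabulary of the planner's rungs; cell form): single-axis
twin textures presented by pairwise disjoint bounded open convex cells with separating normals satisfy
`6·2^{1/3}(√2·Vol)^{2/3} ≤ Fr + (1/√6)·Σ_{j,j' : τ_j ≠ τ_j'} |⟪w, ν_{jj'}⟫|·facetArea(cl Q_j ∩ cl Q_j')`
for every horizontal `⟨112⟩` direction `w` (`w ⊥ m`, `w ⊥ u`, `u` a horizontal bond and mirror normal). -/
theorem rung_singleAxis_cells : let Λ : Set (EuclideanSpace ℝ (Fin 3)) := Literature.MathematicalPhysics.StatisticalMechanics.fccStacking 1 (Real.sqrt (2 / 3)); let Brl : (ℤ → ℤ) → Set (EuclideanSpace ℝ (Fin 3)) := Literature.MathematicalPhysics.StatisticalMechanics.barlowStacking 1 (Real.sqrt (2 / 3)); let Ax : EuclideanSpace ℝ (Fin 3) → (EuclideanSpace ℝ (Fin 3) ≃ₗᵢ[ℝ] EuclideanSpace ℝ (Fin 3)) → (EuclideanSpace ℝ (Fin 3) ≃ₗᵢ[ℝ] EuclideanSpace ℝ (Fin 3)) → Prop := fun m A B => ∃ (L : EuclideanSpace ℝ (Fin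 3) ≃ₗᵢ[ℝ] EuclideanSpace ℝ (Fin 3)) (s₁ s₂ : EuclideanSpace ℝ (Fin 3)) (σ σ' : ℤ → ℤ), Literature.MathematicalPhysics.StatisticalMechanics.IsHaggSeq σ ∧ Literature.MathematicalPhysics.StatisticalMechanics.IsHaggSeq σ' ∧ L (EuclideanSpace.single (2 : Fin 3) (1 : ℝ)) = m ∧ A '' Λ ⊆ (fun q => L q + s₁) '' Brl σ ∧ B '' Λ ⊆ (fun q => L q + s₂) '' Brl σ'; let Φ : EuclideanSpace ℝ (Fin 3) → ℝ := fun ν => Real.sqrt 2 / 4 * ∑ᶠ w ∈ {w ∈ Λ | ‖w‖ = 1}, |⟪w, ν⟫_ℝ|; let Per : Set (EuclideanSpace ℝ (Fin 3)) → Set (EuclideanSpace ℝ (Fin 3)) → ℝ := fun K S => (⨆ (ξ : EuclideanSpace ℝ (Fin 3) → EuclideanSpace ℝ (Fin 3)) (_ : ContDiff ℝ 1 ξ ∧ HasCompactSupport ξ ∧ ∀ z, ξ z ∈ K), ENNReal.ofReal (∫ z in S, Literature.MathematicalPhysics.StatisticalMechanics.fieldDivergence ξ z)).toReal; let ι : Set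 (EuclideanSpace ℝ (Fin 3)) → Set (EuclideanSpace ℝ (Fin 3)) → Set (EuclideanSpace ℝ (Fin 3)) → ℝ := fun K S₁ S₂ => (Per K S₁ + Per K S₂ - Per K (S₁ ∪ S₂)) / 2; let W : (EuclideanSpace ℝ (Fin 3) ≃ₗᵢ[ℝ] EuclideanSpace ℝ (Fin 3)) → Set (EuclideanSpace ℝ (Fin 3)) := fun A => {y | ∀ ν : EuclideanSpace ℝ (Fin 3), ⟪y, ν⟫_ℝ ≤ Φ (A.symm ν)}; let Vol : (n : ℕ) → (Fin n → Set (EuclideanSpace ℝ (Fin 3))) → ℝ := fun n G => (volume (⋃ f : Fin n, G f)).toReal; let Fr : (n : ℕ) → (Fin n → Set (EuclideanSpace ℝ (Fin 3))) → (Fin n → (EuclideanSpace ℝ (Fin 3) ≃ₗᵢ[ℝ] EuclideanSpace ℝ (Fin 3))) → ℝ := fun n G A => ∑ f : Fin n, Per (W (A f)) (G f) - ∑ f, ∑ g, (if f = g then 0 else ι (W (A f)) (G f) (G g)); ∀ (k : ℕ) (H : Fin k → Finset ((EuclideanSpace ℝ (Fin 3)) × ℝ)) (A : Fin k → (EuclideanSpace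 ℝ (Fin 3) ≃ₗᵢ[ℝ] EuclideanSpace ℝ (Fin 3))) (nv : Fin k → Fin k → EuclideanSpace ℝ (Fin 3)) (τ : Fin k → Bool) (m u w : EuclideanSpace ℝ (Fin 3)), (∀ j, Bornology.IsBounded (⋂ p ∈ H j, {x : EuclideanSpace ℝ (Fin 3) | ⟪p.1, x⟫_ℝ < p.2})) → (∀ j j', j ≠ j' → Disjoint (⋂ p ∈ H j, {x : EuclideanSpace ℝ (Fin 3) | ⟪p.1, x⟫_ℝ < p.2}) (⋂ p ∈ H j', {x : EuclideanSpace ℝ (Fin 3) | ⟪p.1, x⟫_ℝ < p.2})) → (∀ i j, nv j i = -nv i j) → (∀ j j', j ≠ j' → ‖nv j j'‖ = 1 ∧ ∃ b : ℝ, closure (⋂ p ∈ H j, {x : EuclideanSpace ℝ (Fin 3) | ⟪p.1, x⟫_ℝ < p.2}) ∩ closure (⋂ p ∈ H j', {x : EuclideanSpace ℝ (Fin 3) | ⟪p.1, x⟫_ℝ < p.2}) ⊆ {x | ⟪nv j j', x⟫_ℝ = b}) → (∀ j j', Ax m (A j) (A j')) → (∀ j j', τ j = τ j' → W (A j) = W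 (A j')) → ‖u‖ = 1 → ‖w‖ = 1 → ⟪u, m⟫_ℝ = 0 → ⟪w, m⟫_ℝ = 0 → ⟪w, u⟫_ℝ = 0 → (∀ j, u ∈ A j '' Λ) → (∀ j, (ℝ ∙ u)ᗮ.reflection '' (A j '' Λ) = A j '' Λ) → 6 * (2 : ℝ) ^ ((1 : ℝ) / 3) * (Real.sqrt 2 * Vol k (fun j => ⋂ p ∈ H j, {x : EuclideanSpace ℝ (Fin 3) | ⟪p.1, x⟫_ℝ < p.2})) ^ ((2 : ℝ) / 3) ≤ Fr k (fun j => ⋂ p ∈ H j, {x : EuclideanSpace ℝ (Fin 3) | ⟪p.1, x⟫_ℝ < p.2}) A + 1 / Real.sqrt 6 * ∑ j, ∑ j', (if τ j = τ j' then 0 else |⟪w, nv j j'⟫_ℝ| * facetArea (closure (⋂ p ∈ H j, {x : EuclideanSpace ℝ (Fin 3) | ⟪p.1, x⟫_ℝ < p.2}) ∩ closure (⋂ p ∈ H j', {x : EuclideanSpace ℝ (Fin 3) | ⟪p.1, x⟫_ℝ < p.2})) (nv j j')) := by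
  intro Λ Brl Ax Φ Per ι W Vol Fr k H A nv τ m u w hbd hdisj hanti hplane hAx hτ hu hw hum hwm hwu hbond hmir
  classical
  set Q : Fin k → Set E3 := fun j => ⋂ p ∈ H j, {x : E3 | ⟪p.1, x⟫_ℝ < p.2} with hQ
  have hQpoly : ∀ j, Q j = polytope (H j) := fun j => rfl
  set Bd : Fin k → Set E3 := fun j => W (A j) with hBd
  set term : Fin k → Fin k → ℝ := fun i j =>
    |⟪w, nv i j⟫_ℝ| * facetArea (closure (Q i) ∩ closure (Q j)) (nv i j) with hterm
  set S : ℝ := ∑ j, ∑ j', (if τ j = τ j' then 0 else term j j') with hS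
  show 6 * (2 : ℝ) ^ ((1 : ℝ) / 3) * (Real.sqrt 2 * (volume (⋃ j, Q j)).toReal) ^ ((2 : ℝ) / 3) ≤
    (∑ f, Per (W (A f)) (Q f) - ∑ f, ∑ g, (if f = g then 0 else ι (W (A f)) (Q f) (Q g))) +
      1 / Real.sqrt 6 * S
  rw [← Finset.sum_sub_distrib]
  set F : ℝ := ∑ f, (Per (W (A f)) (Q f) - ∑ g, (if f = g then 0 else ι (W (A f)) (Q f) (Q g))) with hF
  have hQo : ∀ j, IsOpen (Q j) := fun j =>
    isOpen_biInter_finset fun q _ => isOpen_lt (continuous_const.inner continuous_id) continuous_const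
  have hQm : ∀ j, MeasurableSet (Q j) := fun j => (hQo j).measurableSet
  have hQv : ∀ j, Convex ℝ (Q j) := fun j =>
    convex_iInter₂ fun q _ => convex_halfSpace_lt (innerSL ℝ q.1).isLinear q.2
  have hvolQ : ∀ j, volume (Q j) < ⊤ := by
    intro j
    obtain ⟨R, hR⟩ := (hbd j).subset_closedBall 0
    exact lt_of_le_of_lt (measure_mono hR) measure_closedBall_lt_top
  have hPolyQ : ∀ j, ∃ (k' : ℕ) (H' : Fin k' → Finset (E3 × ℝ)), Q j = ⋃ i, polytope (H' i) :=
    fun j => ⟨1, fun _ => H j, by rw [hQpoly]; ext x; simp⟩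
  have hWc : ∀ f, IsCompact (W (A f)) := fun f => isCompact_cruxWulffBody (A f)
  have hWv : ∀ f, Convex ℝ (W (A f)) := fun f => convex_cruxWulffBody (A f)
  have hW0 : ∀ f, (0 : E3) ∈ W (A f) := fun f => zero_mem_cruxWulffBody (A f)
  have hWs : ∀ f, -W (A f) = W (A f) := fun f => neg_cruxWulffBody_eq (A f)
  have hFr0 : 0 ≤ F := by
    have h := freeEnergy_ge_mul_perimeter Q hPolyQ hvolQ hdisj (fun f => W (A f)) hWc hWv hW0 hWs
      (Real.sqrt_pos.2 (by norm_num : (0:ℝ) < 3)) (fun f => closedBall_subset_cruxWulffBody (A f))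
    exact le_trans (mul_nonneg (Real.sqrt_nonneg 3) ENNReal.toReal_nonneg) h
  have hterm0 : ∀ i j, 0 ≤ term i j := fun i j => mul_nonneg (abs_nonneg _) ENNReal.toReal_nonneg
  have htermsymm : ∀ i j, term j i = term i j := by
    intro i j
    simp only [hterm]
    rw [hanti i j, inner_neg_right, abs_neg, Set.inter_comm, facetArea_neg]
  have hS0 : 0 ≤ S := Finset.sum_nonneg fun j _ => Finset.sum_nonneg fun j' _ => by
    split_ifs; exacts [le_rfl, hterm0 j j']
  set V : ℝ := (volume (⋃ j, Q j)).toReal with hV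
  have hV0 : 0 ≤ V := ENNReal.toReal_nonneg
  have hE'top : volume (⋃ j, Q j) ≠ ⊤ := by
    refine (lt_of_le_of_lt (measure_iUnion_le _) ?_).ne
    rw [tsum_fintype]
    exact ENNReal.sum_lt_top.2 fun f _ => hvolQ f
  have h6 : (0 : ℝ) < Real.sqrt 6 := Real.sqrt_pos.2 (by norm_num)
  by_cases hE'0 : volume (⋃ j, Q j) = 0
  · have hV00 : V = 0 := by rw [hV, hE'0, ENNReal.toReal_zero]
    rw [hV00, mul_zero, Real.zero_rpow (by norm_num), mul_zero]
    exact add_nonneg hFr0 (mul_nonneg (by positivity) hS0)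
  have hVpos : 0 < V := ENNReal.toReal_pos hE'0 hE'top
  obtain ⟨x₀, hx₀⟩ := nonempty_of_measure_ne_zero hE'0
  obtain ⟨j₀, -⟩ := mem_iUnion.1 hx₀
  have hm : ‖m‖ = 1 := by
    obtain ⟨L, -, -, -, -, -, -, hLm, -, -⟩ := hAx j₀ j₀
    rw [← hLm, LinearIsometryEquiv.norm_map, PiLp.norm_single, norm_one]
  have htwo : ∀ i j, τ i ≠ τ j₀ → τ j ≠ τ j₀ → Bd i = Bd j := by
    intro i j hi hj
    apply hτ
    revert hi hj
    cases τ i <;> cases τ j <;> cases τ j₀ <;> decide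
  set D : ℝ := 2 / Real.sqrt 6 with hD
  have hDpos : 0 < D := by positivity
  have hD0 : D ≠ 0 := hDpos.ne'
  set c : ℝ := (32 : ℝ) ^ ((3 : ℝ)⁻¹) with hc
  have hc0 : 0 < c := by positivity
  have key : ∀ ε : ℝ, 0 < ε → 3 * c * (V ^ ((3 : ℝ)⁻¹)) ^ 2 ≤ F + 1 / Real.sqrt 6 * S + ε := by
    intro ε hε
    obtain ⟨r₁, hr₁, hup⟩ := volume_chimera_texture_le Q hPolyQ hvolQ hdisj (fun f => W (A f))
      hWc hWv hW0 hWs (show (0:ℝ) < ε / 3 by positivity)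
    set ε₂ : ℝ := ε / (3 * D * ((k : ℝ) ^ 2 + 1)) with hε₂
    have hε₂pos : 0 < ε₂ := by positivity
    have hpair : ∀ i j : Fin k, ∃ ρ₀ : ℝ, 0 < ρ₀ ∧ ∀ ρ : ℝ, 0 < ρ → ρ < ρ₀ → i ≠ j →
        (volume (Q j ∩ {x : E3 | ∃ s ∈ Icc (-ρ) ρ, x + s • w ∈ Q i})).toReal ≤ ρ * (term i j + ε₂) := by
      intro i j
      by_cases hij : i = j
      · exact ⟨1, one_pos, fun ρ _ _ h => absurd hij h⟩
      · obtain ⟨hν, b, hb⟩ := hplane i j hij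
        obtain ⟨ρ₀, hρ₀, h⟩ := volume_lineTrimE3_le u w m hu hw hm hum hwm hwu (hQo i) (hQo j) (hQv i)
          (hQv j) (hdisj i j hij) (hbd j) hν hb hε₂pos
        exact ⟨ρ₀, hρ₀, fun ρ hρ hρρ₀ _ => h ρ hρ hρρ₀⟩
    choose ρ0 hρ0pos hρ0 using hpair
    have huniv : (Finset.univ : Finset (Fin k × Fin k)).Nonempty := ⟨(j₀, j₀), Finset.mem_univ _⟩
    set ρbar : ℝ := Finset.univ.inf' huniv (fun p : Fin k × Fin k => ρ0 p.1 p.2) with hρbar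
    have hρbar_pos : 0 < ρbar := by
      rw [hρbar, Finset.lt_inf'_iff]; intro p _; exact hρ0pos p.1 p.2
    have hρbar_le : ∀ i j, ρbar ≤ ρ0 i j := fun i j =>
      Finset.inf'_le (fun p : Fin k × Fin k => ρ0 p.1 p.2) (Finset.mem_univ (i, j))
    set TAB : ℝ := ∑ j, ∑ i, (if (τ i = τ j₀ ∧ τ j ≠ τ j₀) then term i j else 0) with hTAB
    have hTAB0 : 0 ≤ TAB := Finset.sum_nonneg fun j _ => Finset.sum_nonneg fun i _ => by
      split_ifs; exacts [hterm0 i j, le_rfl]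
    have hTABS : 2 * TAB ≤ S := by
      have hswap : TAB = ∑ j, ∑ i, (if (τ j = τ j₀ ∧ τ i ≠ τ j₀) then term j i else 0) := by
        rw [hTAB, Finset.sum_comm]
      have hTAB' : TAB = ∑ j, ∑ i, (if (τ j = τ j₀ ∧ τ i ≠ τ j₀) then term i j else 0) := by
        rw [hswap]
        refine Finset.sum_congr rfl fun j _ => Finset.sum_congr rfl fun i _ => ?_
        rw [htermsymm]
      have hsum : TAB + TAB ≤ S := by
        have e1 : TAB + TAB =
            TAB + ∑ j, ∑ i, (if (τ j = τ j₀ ∧ τ i ≠ τ j₀) then term i j else 0) := by rw [← hTAB']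
        rw [e1, hTAB, ← Finset.sum_add_distrib, hS]
        refine Finset.sum_le_sum fun j _ => ?_
        rw [← Finset.sum_add_distrib]
        refine Finset.sum_le_sum fun i _ => ?_
        by_cases h1 : τ i = τ j₀ ∧ τ j ≠ τ j₀
        · have hne : τ j ≠ τ i := fun h => h1.2 (h.trans h1.1)
          have h2 : ¬ (τ j = τ j₀ ∧ τ i ≠ τ j₀) := fun h => h.2 h1.1
          rw [if_pos h1, if_neg h2, if_neg hne, add_zero]
          exact (htermsymm i j).ge
        · rw [if_neg h1, zero_add]
          by_cases h2 : τ j = τ j₀ ∧ τ i ≠ τ j₀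
          · have hne : τ j ≠ τ i := fun h => h2.2 (h.symm.trans h2.1)
            rw [if_pos h2, if_neg hne]
            exact (htermsymm i j).ge
          · rw [if_neg h2]
            split_ifs; exacts [le_rfl, hterm0 j i]
      linarith only [hsum]
    set K : ℝ := TAB + (k : ℝ) ^ 2 * ε₂ with hK
    have hK0 : 0 ≤ K := by positivity
    set x : ℝ := V ^ ((3 : ℝ)⁻¹) with hx
    have hxpos : 0 < x := Real.rpow_pos_of_pos hVpos _
    have hx3 : x ^ 3 = V := by
      rw [hx, show ((3 : ℝ)⁻¹) = ((3 : ℕ) : ℝ)⁻¹ by norm_num]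
      exact Real.rpow_inv_natCast_pow hV0 (by norm_num)
    set r : ℝ := min (min (r₁ / 2) (ρbar / (2 * D))) (min (V / (2 * D * (K + 1)))
      (ε * x / (18 * c * D * (K + 1)))) with hr
    have hr0 : 0 < r := by positivity
    clear_value r K TAB x ρbar ε₂
    have hrr₁ : r < r₁ := by
      have h : r ≤ r₁ / 2 := by rw [hr]; exact (min_le_left _ _).trans (min_le_left _ _)
      linarith only [h, hr₁]
    have hrcD : 0 ≤ r * c * D := (mul_pos (mul_pos hr0 hc0) hDpos).le
    have hrD0 : 0 ≤ r * D := (mul_pos hr0 hDpos).le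
    have hrD : r * D < ρbar := by
      have h : r ≤ ρbar / (2 * D) := by rw [hr]; exact (min_le_left _ _).trans (min_le_right _ _)
      have h' : r * (2 * D) ≤ ρbar := (le_div_iff₀ (by positivity)).1 h
      have e1 : r * (2 * D) = 2 * (r * D) := by ring
      rw [e1] at h'
      linarith [h', hρbar_pos, hrD0]
    have hrV : r * D * K ≤ V / 2 := by
      have h : r ≤ V / (2 * D * (K + 1)) := by rw [hr]; exact (min_le_right _ _).trans (min_le_left _ _)
      have h' : r * (2 * D * (K + 1)) ≤ V := (le_div_iff₀ (by positivity)).1 h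
      have e1 : r * (2 * D * (K + 1)) = 2 * (r * D * K) + 2 * (r * D) := by ring
      rw [e1] at h'
      linarith [h', hrD0]
    have hrε : 6 * c * (r * D * K) / x ≤ ε / 3 := by
      have h : r ≤ ε * x / (18 * c * D * (K + 1)) := by
        rw [hr]; exact (min_le_right _ _).trans (min_le_right _ _)
      have h' : r * (18 * c * D * (K + 1)) ≤ ε * x := (le_div_iff₀ (by positivity)).1 h
      rw [div_le_iff₀ hxpos]
      have e1 : r * (18 * c * D * (K + 1)) = 18 * (r * c * D * K) + 18 * (r * c * D) := by ring
      have e2 : 6 * c * (r * D * K) = 6 * (r * c * D * K) := by ring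
      rw [e2]
      rw [e1] at h'
      linarith [h', hrcD]
    obtain ⟨ρ, hρ⟩ : ∃ ρ : ℝ, ρ = r * D := ⟨_, rfl⟩
    have hρpos : 0 < ρ := by rw [hρ]; exact mul_pos hr0 hDpos
    obtain ⟨Tr, hTr⟩ : ∃ Tr : Fin k → Fin k → Set E3, Tr = fun i j =>
        if (τ i = τ j₀ ∧ τ j ≠ τ j₀) then Q j ∩ {x : E3 | ∃ s ∈ Icc (-ρ) ρ, x + s • w ∈ Q i} else ∅ :=
      ⟨_, rfl⟩
    obtain ⟨Qt, hQt⟩ : ∃ Qt : Fin k → Set E3, Qt = fun j => Q j \ ⋃ i, Tr i j := ⟨_, rfl⟩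
    have hQt' : ∀ j y, y ∈ Qt j ↔ y ∈ Q j ∧ y ∉ ⋃ i, Tr i j := fun j y => by rw [hQt]; rfl
    have htrim_open : ∀ i, IsOpen {x : E3 | ∃ s ∈ Icc (-ρ) ρ, x + s • w ∈ Q i} := by
      intro i
      have e : {x : E3 | ∃ s ∈ Icc (-ρ) ρ, x + s • w ∈ Q i} =
          ⋃ (s : ℝ) (_ : s ∈ Icc (-ρ) ρ), (fun x => x + s • w) ⁻¹' Q i := by ext x; simp
      rw [e]
      exact isOpen_iUnion fun s => isOpen_iUnion fun _ =>
        (continuous_id.add continuous_const).isOpen_preimage _ (hQo i)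
    have hTrm : ∀ i j, MeasurableSet (Tr i j) := by
      intro i j
      by_cases h : τ i = τ j₀ ∧ τ j ≠ τ j₀
      · simp only [hTr, if_pos h]; exact (hQm j).inter (htrim_open i).measurableSet
      · simp only [hTr, if_neg h]; exact MeasurableSet.empty
    have hQtm : ∀ j, MeasurableSet (Qt j) := fun j => by
      rw [hQt]; exact (hQm j).diff (MeasurableSet.iUnion fun i => hTrm i j)
    have hQtsub : ∀ j, Qt j ⊆ Q j := fun j y hy => ((hQt' j y).1 hy).1
    have hQtdisj : ∀ f g, f ≠ g → Disjoint (Qt f) (Qt g) := fun f g hfg =>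
      (hdisj f g hfg).mono (hQtsub f) (hQtsub g)
    have hsep : ∀ f g, Bd f ≠ Bd g → ∀ x ∈ Qt f, ∀ t : ℝ, |t| ≤ r * (2 / Real.sqrt 6) → x + t • w ∉ Qt g := by
      intro f g hfg x hx t ht hxt
      have htI : t ∈ Icc (-ρ) ρ :=
        ⟨by rw [hρ, hD]; linarith [neg_abs_le t], by rw [hρ, hD]; exact (le_abs_self t).trans ht⟩
      by_cases hf : τ f = τ j₀
      · by_cases hg : τ g = τ j₀
        · exact hfg (hτ f g (hf.trans hg.symm))
        · -- `f` of the first type, `g` of the second: `x + t w` was trimmed from `Q g`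
          have hmem : x + t • w ∈ Tr f g := by
            simp only [hTr, if_pos (And.intro hf hg)]
            refine ⟨hQtsub g hxt, -t, ⟨by linarith [htI.2], by linarith [htI.1]⟩, ?_⟩
            rw [add_assoc, ← add_smul, add_neg_cancel, zero_smul, add_zero]
            exact hQtsub f hx
          exact ((hQt' g _).1 hxt).2 (mem_iUnion.2 ⟨f, hmem⟩)
      · by_cases hg : τ g = τ j₀
        · -- `f` of the second type, `g` of the first: `x` was trimmed from `Q f`
          have hmem : x ∈ Tr g f := by
            simp only [hTr, if_pos (And.intro hg hf)]
            exact ⟨hQtsub f hx, t, htI, hQtsub g hxt⟩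
          exact ((hQt' f _).1 hx).2 (mem_iUnion.2 ⟨g, hmem⟩)
        · exact hfg (htwo f g hf hg)
    have hTrfin : ∀ i j, volume (Tr i j) ≠ ⊤ := by
      intro i j
      by_cases h : τ i = τ j₀ ∧ τ j ≠ τ j₀
      · simp only [hTr, if_pos h]
        exact (lt_of_le_of_lt (measure_mono inter_subset_left) (hvolQ j)).ne
      · simp only [hTr, if_neg h, measure_empty]; exact ENNReal.zero_ne_top
    have hTrvol : ∀ i j, (volume (Tr i j)).toReal ≤
        ρ * (if (τ i = τ j₀ ∧ τ j ≠ τ j₀) then term i j + ε₂ else 0) := by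
      intro i j
      by_cases h : τ i = τ j₀ ∧ τ j ≠ τ j₀
      · simp only [hTr, if_pos h]
        have hij : i ≠ j := fun e => h.2 (e ▸ h.1)
        exact hρ0 i j ρ hρpos (by rw [hρ]; exact lt_of_lt_of_le hrD (hρbar_le i j)) hij
      · simp only [hTr, if_neg h, measure_empty, ENNReal.toReal_zero, mul_zero]; exact le_rfl
    have hQttop : volume (⋃ j, Qt j) ≠ ⊤ :=
      (lt_of_le_of_lt (measure_mono (iUnion_mono hQtsub)) hE'top.lt_top).ne
    have htrimvol : V ≤ (volume (⋃ j, Qt j)).toReal + ρ * K := by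
      have hcover : (⋃ j, Q j) ⊆ (⋃ j, Qt j) ∪ ⋃ j, ⋃ i, Tr i j := by
        intro y hy
        obtain ⟨j, hyj⟩ := mem_iUnion.1 hy
        by_cases h : y ∈ ⋃ i, Tr i j
        · exact Or.inr (mem_iUnion.2 ⟨j, h⟩)
        · exact Or.inl (mem_iUnion.2 ⟨j, (hQt' j y).2 ⟨hyj, h⟩⟩)
      have hsumfin : ∑ j, ∑ i, volume (Tr i j) ≠ ⊤ :=
        ENNReal.sum_ne_top.2 fun j _ => ENNReal.sum_ne_top.2 fun i _ => hTrfin i j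
      have h1 : volume (⋃ j, Q j) ≤ volume (⋃ j, Qt j) + ∑ j, ∑ i, volume (Tr i j) := by
        calc volume (⋃ j, Q j) ≤ volume ((⋃ j, Qt j) ∪ ⋃ j, ⋃ i, Tr i j) := measure_mono hcover
          _ ≤ volume (⋃ j, Qt j) + volume (⋃ j, ⋃ i, Tr i j) := measure_union_le _ _
          _ ≤ volume (⋃ j, Qt j) + ∑ j, ∑ i, volume (Tr i j) := by
              gcongr
              refine (measure_iUnion_le _).trans ?_
              rw [tsum_fintype]
              refine Finset.sum_le_sum fun j _ => (measure_iUnion_le _).trans ?_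
              rw [tsum_fintype]
      have h2 := ENNReal.toReal_mono (ENNReal.add_ne_top.2 ⟨hQttop, hsumfin⟩) h1
      rw [ENNReal.toReal_add hQttop hsumfin,
        ENNReal.toReal_sum (fun j _ => ENNReal.sum_ne_top.2 fun i _ => hTrfin i j)] at h2
      have h3 : ∑ j, (∑ i, volume (Tr i j)).toReal ≤ ρ * K := by
        calc ∑ j, (∑ i, volume (Tr i j)).toReal = ∑ j, ∑ i, (volume (Tr i j)).toReal :=
              Finset.sum_congr rfl fun j _ => ENNReal.toReal_sum fun i _ => hTrfin i j
          _ ≤ ∑ j, ∑ i, ρ * (if (τ i = τ j₀ ∧ τ j ≠ τ j₀) then term i j + ε₂ else 0) :=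
              Finset.sum_le_sum fun j _ => Finset.sum_le_sum fun i _ => hTrvol i j
          _ = ρ * ∑ j, ∑ i, (if (τ i = τ j₀ ∧ τ j ≠ τ j₀) then term i j + ε₂ else 0) := by
              rw [Finset.mul_sum]; refine Finset.sum_congr rfl fun j _ => ?_; rw [Finset.mul_sum]
          _ ≤ ρ * K := by
              gcongr
              rw [hK, hTAB]
              calc ∑ j, ∑ i, (if (τ i = τ j₀ ∧ τ j ≠ τ j₀) then term i j + ε₂ else 0)
                  ≤ ∑ j, ∑ i, ((if (τ i = τ j₀ ∧ τ j ≠ τ j₀) then term i j else 0) + ε₂) := by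
                    refine Finset.sum_le_sum fun j _ => Finset.sum_le_sum fun i _ => ?_
                    split_ifs; exacts [le_rfl, by rw [zero_add]; exact hε₂pos.le]
                _ = (∑ j, ∑ i, (if (τ i = τ j₀ ∧ τ j ≠ τ j₀) then term i j else 0)) +
                      (k : ℝ) ^ 2 * ε₂ := by
                    simp only [Finset.sum_add_distrib, Finset.sum_const, Finset.card_univ,
                      Fintype.card_fin]
                    ring
      linarith only [h2, h3]
    have hV'pos : 0 < (volume (⋃ j, Qt j)).toReal := by
      have : ρ * K ≤ V / 2 := by rw [hρ]; exact hrV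
      linarith only [htrimvol, this, hVpos]
    have hQt0 : volume (⋃ j, Qt j) ≠ 0 := fun h => by
      rw [h, ENNReal.toReal_zero] at hV'pos; exact lt_irrefl _ hV'pos
    obtain ⟨C, hC⟩ : ∃ C : Set E3, C = ⋃ f, ⋃ y ∈ Q f, y +ᵥ (r • W (A f)) := ⟨_, rfl⟩
    have hCopen : IsOpen C := by
      have hCeq : C = ⋃ f, ⋃ w' ∈ r • W (A f), (fun y => y + w') '' Q f := by
        ext y
        simp only [hC, mem_iUnion, Set.mem_vadd_set, vadd_eq_add, mem_image, exists_prop]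
        constructor
        · rintro ⟨f, z, hz, w', hw', rfl⟩; exact ⟨f, w', hw', z, hz, rfl⟩
        · rintro ⟨f, w', hw', z, hz, rfl⟩; exact ⟨f, z, hz, w', hw', rfl⟩
      rw [hCeq]
      exact isOpen_iUnion fun f => isOpen_biUnion fun w' _ => (isOpenMap_add_right w') _ (hQo f)
    have hCm : MeasurableSet C := hCopen.measurableSet
    have hEbd : Bornology.IsBounded (⋃ f, Q f) := Bornology.isBounded_iUnion.2 fun f => hbd f
    have hCfin : volume C ≠ ⊤ := by
      obtain ⟨R₁, hR₁⟩ := hEbd.subset_closedBall 0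
      have hCsub : C ⊆ Metric.closedBall (0 : E3) (R₁ + r * Real.sqrt 5) := by
        intro y hy
        rw [hC] at hy
        simp only [mem_iUnion, Set.mem_vadd_set, vadd_eq_add, exists_prop] at hy
        obtain ⟨f, z, hz, w', hw', rfl⟩ := hy
        obtain ⟨w5, hw5, rfl⟩ := Set.mem_smul_set.1 hw'
        have hz' : ‖z‖ ≤ R₁ := mem_closedBall_zero_iff.1 (hR₁ (mem_iUnion.2 ⟨f, hz⟩))
        have hw5' : ‖w5‖ ≤ Real.sqrt 5 :=
          mem_closedBall_zero_iff.1 (cruxWulffBody_subset_closedBall (A f) hw5)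
        rw [mem_closedBall_zero_iff]
        calc ‖z + r • w5‖ ≤ ‖z‖ + ‖r • w5‖ := norm_add_le _ _
          _ = ‖z‖ + r * ‖w5‖ := by rw [norm_smul, Real.norm_of_nonneg hr0.le]
          _ ≤ R₁ + r * Real.sqrt 5 := by gcongr
      exact (lt_of_le_of_lt (measure_mono hCsub) measure_closedBall_lt_top).ne
    have hlow := slide_chimera_lower m u w hu hw hum hwm hwu Qt hQtm hQtdisj A hAx hbond hmir hr0
      hsep hQt0 hQttop hCm
      (fun f z hz y hy => by
        rw [hC]
        exact mem_iUnion.2 ⟨f, mem_iUnion₂.2 ⟨z, hQtsub f hz,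
          Set.mem_vadd_set.2 ⟨r • y, Set.smul_mem_smul_set hy, rfl⟩⟩⟩)
    have hupC : (volume C).toReal ≤ V + r * (F + ε / 3) := by rw [hC]; exact hup r hr0 hrr₁
    obtain ⟨V', hV'⟩ : ∃ V' : ℝ, V' = (volume (⋃ j, Qt j)).toReal := ⟨_, rfl⟩
    have hexp : (((3 : ℕ) : ℝ)⁻¹) = (3 : ℝ)⁻¹ := by norm_num
    have h1 : V' ^ ((3 : ℝ)⁻¹) + r * c ≤ (volume C).toReal ^ ((3 : ℝ)⁻¹) := by
      have h := ENNReal.toReal_mono (ENNReal.rpow_ne_top_of_nonneg (by positivity) hCfin) hlow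
      rw [ENNReal.toReal_add (ENNReal.rpow_ne_top_of_nonneg (by positivity) hQttop)
          (ENNReal.mul_ne_top ENNReal.ofReal_ne_top (ENNReal.rpow_ne_top_of_nonneg (by positivity)
            ENNReal.ofReal_ne_top)),
        ENNReal.toReal_mul, ENNReal.toReal_ofReal hr0.le, ← ENNReal.toReal_rpow, ← ENNReal.toReal_rpow,
        ← ENNReal.toReal_rpow, ENNReal.toReal_ofReal (by norm_num : (0:ℝ) ≤ 32), hexp, ← hV'] at h
      exact h
    obtain ⟨x', hx'⟩ : ∃ x' : ℝ, x' = V' ^ ((3 : ℝ)⁻¹) := ⟨_, rfl⟩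
    rw [← hx'] at h1
    have hV'0 : 0 ≤ V' := by rw [hV']; exact ENNReal.toReal_nonneg
    have hx'0 : 0 ≤ x' := by rw [hx']; positivity
    have hx'3 : x' ^ 3 = V' := by
      rw [hx', show ((3 : ℝ)⁻¹) = ((3 : ℕ) : ℝ)⁻¹ by norm_num]
      exact Real.rpow_inv_natCast_pow hV'0 (by norm_num)
    have hC3 : ((volume C).toReal ^ ((3 : ℝ)⁻¹)) ^ 3 = (volume C).toReal := by
      rw [show ((3 : ℝ)⁻¹) = ((3 : ℕ) : ℝ)⁻¹ by norm_num]
      exact Real.rpow_inv_natCast_pow ENNReal.toReal_nonneg (by norm_num)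
    have h2 : (x' + r * c) ^ 3 ≤ V + r * (F + ε / 3) := by
      calc (x' + r * c) ^ 3 ≤ ((volume C).toReal ^ ((3 : ℝ)⁻¹)) ^ 3 := by gcongr
        _ = (volume C).toReal := hC3
        _ ≤ V + r * (F + ε / 3) := hupC
    have hVV' : V ≤ V' + r * D * K := by rw [hV', ← hρ]; exact htrimvol
    have hV'V : V' ≤ V := by
      rw [hV', hV]
      exact ENNReal.toReal_mono hE'top (measure_mono (iUnion_mono hQtsub))
    have hDK : D * K ≤ 1 / Real.sqrt 6 * S + ε / 3 := by
      rw [hK, mul_add]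
      have hA : D * TAB ≤ 1 / Real.sqrt 6 * S := by
        rw [hD]
        have : 2 / Real.sqrt 6 * TAB = 1 / Real.sqrt 6 * (2 * TAB) := by ring
        rw [this]
        exact mul_le_mul_of_nonneg_left hTABS (by positivity)
      have hB : D * ((k : ℝ) ^ 2 * ε₂) ≤ ε / 3 := by
        rw [hε₂]
        have e : D * ((k : ℝ) ^ 2 * (ε / (3 * D * ((k : ℝ) ^ 2 + 1)))) =
            ε / 3 * ((k : ℝ) ^ 2 / ((k : ℝ) ^ 2 + 1)) := by field_simp
        rw [e]
        have hk1 : (k : ℝ) ^ 2 / ((k : ℝ) ^ 2 + 1) ≤ 1 := by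
          rw [div_le_one (by positivity)]; exact le_add_of_nonneg_right zero_le_one
        calc ε / 3 * ((k : ℝ) ^ 2 / ((k : ℝ) ^ 2 + 1)) ≤ ε / 3 * 1 :=
              mul_le_mul_of_nonneg_left hk1 (by positivity)
          _ = ε / 3 := mul_one _
      linarith only [hA, hB]
    exact cube_tail_bound hr0 hc0 hxpos hx'0 hx3 hx'3 hV'V hVV' h2 hrε hDK
  rw [wulff_constant_eq hV0]
  exact le_of_forall_pos_le_add key

end Summit.Ventures.Crystal3D.Cruxes.PolycrystalWulffBound.PolyDensity

end
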